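import Literature.MathematicalPhysics.StatisticalMechanics.HcpFccLatticeSumsSecondDiff

/-!
# Certified hcp/fcc lattice sums: tails of the registry couplings

`registryCoupling n s − (∑_{box R} (Q₀+s)⁻ⁿ − ∑_{box R} (Q₁+s)⁻ⁿ) = ∑'_{ij ∉ box R} sd(ij)`
(`registryCoupling_sub_box_eq`: the complement of a square is symmetric, so the offset tail equals
its reflection, `tsum_compl_box_neg`), and `|∑' sd| ≤ C ∑'_{∉ box R} (Q₀+s)^{-(n+1)}`; with the
termwise bounds of `HcpFccLatticeSumsSecondDiff.lean` and the shell tails of `…Tail.lean`: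

* `registryCoupling_three_tail`: `|J⁽³⁾(s) − box parts| ≤ (207/20)(32/9)((3/4)R² + s)⁻³`
  (`R ≥ 40`, `s ≥ 0`); `registryCoupling_three_abs`: `|J⁽³⁾(s)| ≤ (207/20)(s⁻⁴ + (32/9)s⁻³)`
  (`s ≥ 320`);
* `registryCoupling_six_tail` (`R ≥ 20`, constant `(317/5)(16/9)`), `registryCoupling_six_abs`
  (`s ≥ 100`).

These are the only analytic inputs of the certificate besides the shell tails; the true couplings decay
exponentially in `√s`, the bounds used are the elementary power laws.  [folklore]
-/

noncomputable section

namespace Literature.MathematicalPhysics.StatisticalMechanics.StackingSums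

open Finset

/-! ## Symmetric reindexing of the complement of a box -/

/-- A sum over the complement of a box is invariant under negation of the index. [folklore] -/
theorem tsum_compl_box_neg (R : ℕ) (g : ℤ × ℤ → ℝ) :
    ∑' ij : {ij : ℤ × ℤ // ij ∉ box R}, g (-(ij : ℤ × ℤ)) =
      ∑' ij : {ij : ℤ × ℤ // ij ∉ box R}, g ij :=
  (boxComplNeg R).tsum_eq fun ij => g ij

/-- A sum over `box 0` is the value at the origin. [folklore] -/
theorem sum_box_zero (f : ℤ × ℤ → ℝ) : ∑ ij ∈ box 0, f ij = f ((0 : ℤ), (0 : ℤ)) := by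
  rw [box_zero, sum_singleton]

/-- Summability on the complement, and of the reflected offset term. [folklore] -/
theorem summable_compl_box {δ : ℕ} (hδ : δ ≤ 1) {s : ℝ} (hs : 0 ≤ s) {n : ℕ} (hn : 2 ≤ n) (R : ℕ) :
    Summable (fun ij : {ij : ℤ × ℤ // ij ∉ box R} => layerTerm δ n s ij) ∧
    Summable (fun ij : {ij : ℤ × ℤ // ij ∉ box R} => layerTerm δ n s (-(ij : ℤ × ℤ))) := by
  have h1 : Summable (fun ij : {ij : ℤ × ℤ // ij ∉ box R} => layerTerm δ n s ij) :=
    (layerTerm_summable hδ hs hn).subtype _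
  refine ⟨h1, ?_⟩
  have h2 := (boxComplNeg R).summable_iff.mpr h1
  exact h2

/-- **The tail of the registry coupling is a sum of symmetric second differences**: for
`s ≥ 0`, `n ≥ 2` and every `R`,
`J⁽ⁿ⁾(s) − (∑_{box R} (Q₀+s)⁻ⁿ − ∑_{box R} (Q₁+s)⁻ⁿ) = ∑'_{ij ∉ box R} sd(ij)`,
`sd(ij) = layerTerm 0 ij − ½ layerTerm 1 ij − ½ layerTerm 1 (−ij)`. [folklore] -/
theorem registryCoupling_sub_box_eq {n : ℕ} (hn : 2 ≤ n) {s : ℝ} (hs : 0 ≤ s) (R : ℕ) :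
    registryCoupling n s - (∑ ij ∈ box R, layerTerm 0 n s ij - ∑ ij ∈ box R, layerTerm 1 n s ij) =
      ∑' ij : {ij : ℤ × ℤ // ij ∉ box R},
        (layerTerm 0 n s ij - 1 / 2 * layerTerm 1 n s ij - 1 / 2 * layerTerm 1 n s (-(ij : ℤ × ℤ))) := by
  have h0 := layerSum_eq_sum_box_add_tsum_compl (δ := 0) zero_le_one hs hn R
  have h1 := layerSum_eq_sum_box_add_tsum_compl (δ := 1) le_rfl hs hn R
  obtain ⟨hs0, -⟩ := summable_compl_box (δ := 0) zero_le_one hs hn R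
  obtain ⟨hs1, hs1'⟩ := summable_compl_box (δ := 1) le_rfl hs hn R
  have hneg := tsum_compl_box_neg R (fun ij => layerTerm 1 n s ij)
  unfold registryCoupling
  rw [h0, h1, Summable.tsum_sub (hs0.sub (hs1.mul_left (1 / 2))) (hs1'.mul_left (1 / 2)),
    Summable.tsum_sub hs0 (hs1.mul_left (1 / 2)), tsum_mul_left, tsum_mul_left, hneg]
  ring

/-- **Bounding a sum of second differences**: a termwise bound `|sd| ≤ C · layerTerm 0 m s` on the
complement of `box R` (with `m ≥ 2`, `s ≥ 0`) gives
`|∑'_{∉ box R} sd| ≤ C · ∑'_{∉ box R} layerTerm 0 m s`. [folklore] -/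
theorem abs_tsum_compl_box_le {n m : ℕ} (hm : 2 ≤ m) {s : ℝ} (hs : 0 ≤ s) {R : ℕ}
    {C : ℝ} (hbound : ∀ i j : ℤ, (i, j) ∉ box R →
      |layerTerm 0 n s (i, j) - 1 / 2 * layerTerm 1 n s (i, j) - 1 / 2 * layerTerm 1 n s (-i, -j)| ≤
        C * layerTerm 0 m s (i, j)) :
    |∑' ij : {ij : ℤ × ℤ // ij ∉ box R},
        (layerTerm 0 n s ij - 1 / 2 * layerTerm 1 n s ij - 1 / 2 * layerTerm 1 n s (-(ij : ℤ × ℤ)))| ≤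
      C * ∑' ij : {ij : ℤ × ℤ // ij ∉ box R}, layerTerm 0 m s ij := by
  set f : {ij : ℤ × ℤ // ij ∉ box R} → ℝ := fun ij =>
    layerTerm 0 n s ij - 1 / 2 * layerTerm 1 n s ij - 1 / 2 * layerTerm 1 n s (-(ij : ℤ × ℤ)) with hf
  set g : {ij : ℤ × ℤ // ij ∉ box R} → ℝ := fun ij => C * layerTerm 0 m s ij with hg
  have hg_sum : Summable g := ((layerTerm_summable zero_le_one hs hm).subtype _).mul_left C
  have hle : ∀ ij, |f ij| ≤ g ij := by
    rintro ⟨⟨i, j⟩, hij⟩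
    exact hbound i j hij
  have habs : Summable fun ij => |f ij| :=
    Summable.of_nonneg_of_le (fun _ => abs_nonneg _) hle hg_sum
  have h1 : |∑' ij, f ij| ≤ ∑' ij, |f ij| := by
    have := norm_tsum_le_tsum_norm (f := f) (by simpa [Real.norm_eq_abs] using habs)
    simpa [Real.norm_eq_abs] using this
  have h2 : ∑' ij, |f ij| ≤ ∑' ij, g ij := habs.tsum_le_tsum hle hg_sum
  have h3 : ∑' ij, g ij = C * ∑' ij : {ij : ℤ × ℤ // ij ∉ box R}, layerTerm 0 m s ij := tsum_mul_left
  linarith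

/-! ## Registry tails, `n = 3` and `n = 6` -/

/-- **In-plane truncation of `J⁽³⁾`**: for `s ≥ 0` and `R ≥ 40`,
`|J⁽³⁾(s) − (box parts)| ≤ (207/20)·(32/9)·((3/4)R² + s)⁻³`. [folklore] -/
theorem registryCoupling_three_tail {s : ℝ} (hs : 0 ≤ s) {R : ℕ} (hR : 40 ≤ R) :
    |registryCoupling 3 s - (∑ ij ∈ box R, layerTerm 0 3 s ij - ∑ ij ∈ box R, layerTerm 1 3 s ij)| ≤
      207 / 20 * (32 / 9 * ((3 / 4 * (R : ℝ) ^ 2 + s)⁻¹) ^ 3) := by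
  rw [registryCoupling_sub_box_eq (by norm_num) hs R]
  have hb : ∀ i j : ℤ, (i, j) ∉ box R →
      |layerTerm 0 3 s (i, j) - 1 / 2 * layerTerm 1 3 s (i, j) - 1 / 2 * layerTerm 1 3 s (-i, -j)| ≤
        207 / 20 * layerTerm 0 4 s (i, j) := by
    intro i j hij
    obtain ⟨hθ, hP⟩ := inplane_hyp_three hs hR hij
    exact layer_sd_bound_three hs hθ hP
  refine (abs_tsum_compl_box_le (by norm_num) hs hb).trans ?_
  refine mul_le_mul_of_nonneg_left ?_ (by norm_num)
  have hRpos : 0 < (if (0 : ℕ) = 0 then 3 / 4 else 1 / 3 : ℝ) * (R : ℝ) ^ 2 + s := by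
    have : (40 : ℝ) ≤ R := by exact_mod_cast hR
    rw [if_pos rfl]; positivity
  have h := tsum_compl_box_le (δ := 0) zero_le_one hs (d := 3) (by norm_num) hRpos
  have e1 : (8 : ℝ) / ((if (0 : ℕ) = 0 then (3 : ℝ) / 4 else 1 / 3) * ((3 : ℕ) : ℝ)) = 32 / 9 := by
    norm_num
  have e2 : (if (0 : ℕ) = 0 then (3 : ℝ) / 4 else 1 / 3) = 3 / 4 := by norm_num
  rw [e1, e2] at h
  exact h

/-- **The whole coupling `J⁽³⁾`**: for `s ≥ 320`,
`|J⁽³⁾(s)| ≤ (207/20)·(s⁻⁴ + (32/9) s⁻³)`. [folklore] -/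
theorem registryCoupling_three_abs {s : ℝ} (hs : 320 ≤ s) :
    |registryCoupling 3 s| ≤ 207 / 20 * ((s⁻¹) ^ 4 + 32 / 9 * (s⁻¹) ^ 3) := by
  have hs0 : 0 ≤ s := by linarith
  have hsp : 0 < s := by linarith
  have heq := registryCoupling_sub_box_eq (n := 3) (by norm_num) hs0 0
  rw [sum_box_zero, sum_box_zero] at heq
  have hb : ∀ i j : ℤ, (i, j) ∉ box 0 →
      |layerTerm 0 3 s (i, j) - 1 / 2 * layerTerm 1 3 s (i, j) - 1 / 2 * layerTerm 1 3 s (-i, -j)| ≤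
        207 / 20 * layerTerm 0 4 s (i, j) := by
    intro i j _
    obtain ⟨hθ, hP⟩ := layer_hyp_three hs i j
    exact layer_sd_bound_three hs0 hθ hP
  have htail := abs_tsum_compl_box_le (R := 0) (by norm_num) hs0 hb
  -- the single site (0,0): its `sd` is `layerTerm 0 − layerTerm 1`
  have h00 : |layerTerm 0 3 s ((0 : ℤ), (0 : ℤ)) - layerTerm 1 3 s ((0 : ℤ), (0 : ℤ))| ≤
      207 / 20 * layerTerm 0 4 s ((0 : ℤ), (0 : ℤ)) := by
    obtain ⟨hθ, hP⟩ := layer_hyp_three hs 0 0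
    have := layer_sd_bound_three hs0 hθ hP
    simp only [neg_zero] at this
    have e : layerTerm 0 3 s ((0 : ℤ), (0 : ℤ)) - 1 / 2 * layerTerm 1 3 s ((0 : ℤ), (0 : ℤ)) -
        1 / 2 * layerTerm 1 3 s ((0 : ℤ), (0 : ℤ)) =
        layerTerm 0 3 s ((0 : ℤ), (0 : ℤ)) - layerTerm 1 3 s ((0 : ℤ), (0 : ℤ)) := by ring
    rw [e] at this
    exact this
  have hsplit := layerSum_eq_sum_box_add_tsum_compl (δ := 0) zero_le_one hs0 (n := 4) (by norm_num) 0
  rw [sum_box_zero] at hsplit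
  have hfull : layerSum 0 4 s ≤ (s⁻¹) ^ 4 + 32 / 9 * (s⁻¹) ^ 3 := by
    have h := layerSum_le_of_pos (δ := 0) zero_le_one hsp (d := 3) (by norm_num)
    have e : (8 : ℝ) / ((if (0 : ℕ) = 0 then (3 : ℝ) / 4 else 1 / 3) * ((3 : ℕ) : ℝ)) = 32 / 9 := by
      norm_num
    rw [e] at h
    exact h
  have hJ : registryCoupling 3 s =
      (layerTerm 0 3 s ((0 : ℤ), (0 : ℤ)) - layerTerm 1 3 s ((0 : ℤ), (0 : ℤ))) +
      ∑' ij : {ij : ℤ × ℤ // ij ∉ box 0},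
        (layerTerm 0 3 s ij - 1 / 2 * layerTerm 1 3 s ij - 1 / 2 * layerTerm 1 3 s (-(ij : ℤ × ℤ))) := by
    linarith
  rw [hJ]
  refine (abs_add_le _ _).trans ?_
  have hC : 0 ≤ (207 : ℝ) / 20 := by norm_num
  calc |layerTerm 0 3 s ((0 : ℤ), (0 : ℤ)) - layerTerm 1 3 s ((0 : ℤ), (0 : ℤ))| +
      |∑' ij : {ij : ℤ × ℤ // ij ∉ box 0},
        (layerTerm 0 3 s ij - 1 / 2 * layerTerm 1 3 s ij - 1 / 2 * layerTerm 1 3 s (-(ij : ℤ × ℤ)))|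
      ≤ 207 / 20 * layerTerm 0 4 s ((0 : ℤ), (0 : ℤ)) +
        207 / 20 * ∑' ij : {ij : ℤ × ℤ // ij ∉ box 0}, layerTerm 0 4 s ij := add_le_add h00 htail
    _ = 207 / 20 * layerSum 0 4 s := by rw [hsplit]; ring
    _ ≤ 207 / 20 * ((s⁻¹) ^ 4 + 32 / 9 * (s⁻¹) ^ 3) := by
        refine mul_le_mul_of_nonneg_left ?_ hC
        linarith

/-- **In-plane truncation of `J⁽⁶⁾`**: for `s ≥ 0` and `R ≥ 20`,
`|J⁽⁶⁾(s) − (box parts)| ≤ (317/5)·(16/9)·((3/4)R² + s)⁻⁶`. [folklore] -/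
theorem registryCoupling_six_tail {s : ℝ} (hs : 0 ≤ s) {R : ℕ} (hR : 20 ≤ R) :
    |registryCoupling 6 s - (∑ ij ∈ box R, layerTerm 0 6 s ij - ∑ ij ∈ box R, layerTerm 1 6 s ij)| ≤
      317 / 5 * (16 / 9 * ((3 / 4 * (R : ℝ) ^ 2 + s)⁻¹) ^ 6) := by
  rw [registryCoupling_sub_box_eq (by norm_num) hs R]
  have hb : ∀ i j : ℤ, (i, j) ∉ box R →
      |layerTerm 0 6 s (i, j) - 1 / 2 * layerTerm 1 6 s (i, j) - 1 / 2 * layerTerm 1 6 s (-i, -j)| ≤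
        317 / 5 * layerTerm 0 7 s (i, j) := by
    intro i j hij
    obtain ⟨hθ, hP⟩ := inplane_hyp_six hs hR hij
    exact layer_sd_bound_six hs hθ hP
  refine (abs_tsum_compl_box_le (by norm_num) hs hb).trans ?_
  refine mul_le_mul_of_nonneg_left ?_ (by norm_num)
  have hRpos : 0 < (if (0 : ℕ) = 0 then 3 / 4 else 1 / 3 : ℝ) * (R : ℝ) ^ 2 + s := by
    have : (20 : ℝ) ≤ R := by exact_mod_cast hR
    rw [if_pos rfl]; positivity
  have h := tsum_compl_box_le (δ := 0) zero_le_one hs (d := 6) (by norm_num) hRpos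
  have e1 : (8 : ℝ) / ((if (0 : ℕ) = 0 then (3 : ℝ) / 4 else 1 / 3) * ((6 : ℕ) : ℝ)) = 16 / 9 := by
    norm_num
  have e2 : (if (0 : ℕ) = 0 then (3 : ℝ) / 4 else 1 / 3) = 3 / 4 := by norm_num
  rw [e1, e2] at h
  exact h

/-- **The whole coupling `J⁽⁶⁾`**: for `s ≥ 100`,
`|J⁽⁶⁾(s)| ≤ (317/5)·(s⁻⁷ + (16/9) s⁻⁶)`. [folklore] -/
theorem registryCoupling_six_abs {s : ℝ} (hs : 100 ≤ s) :
    |registryCoupling 6 s| ≤ 317 / 5 * ((s⁻¹) ^ 7 + 16 / 9 * (s⁻¹) ^ 6) := by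
  have hs0 : 0 ≤ s := by linarith
  have hsp : 0 < s := by linarith
  have heq := registryCoupling_sub_box_eq (n := 6) (by norm_num) hs0 0
  rw [sum_box_zero, sum_box_zero] at heq
  have hb : ∀ i j : ℤ, (i, j) ∉ box 0 →
      |layerTerm 0 6 s (i, j) - 1 / 2 * layerTerm 1 6 s (i, j) - 1 / 2 * layerTerm 1 6 s (-i, -j)| ≤
        317 / 5 * layerTerm 0 7 s (i, j) := by
    intro i j _
    obtain ⟨hθ, hP⟩ := layer_hyp_six hs i j
    exact layer_sd_bound_six hs0 hθ hP
  have htail := abs_tsum_compl_box_le (R := 0) (by norm_num) hs0 hb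
  have h00 : |layerTerm 0 6 s ((0 : ℤ), (0 : ℤ)) - layerTerm 1 6 s ((0 : ℤ), (0 : ℤ))| ≤
      317 / 5 * layerTerm 0 7 s ((0 : ℤ), (0 : ℤ)) := by
    obtain ⟨hθ, hP⟩ := layer_hyp_six hs 0 0
    have := layer_sd_bound_six hs0 hθ hP
    simp only [neg_zero] at this
    have e : layerTerm 0 6 s ((0 : ℤ), (0 : ℤ)) - 1 / 2 * layerTerm 1 6 s ((0 : ℤ), (0 : ℤ)) -
        1 / 2 * layerTerm 1 6 s ((0 : ℤ), (0 : ℤ)) =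
        layerTerm 0 6 s ((0 : ℤ), (0 : ℤ)) - layerTerm 1 6 s ((0 : ℤ), (0 : ℤ)) := by ring
    rw [e] at this
    exact this
  have hsplit := layerSum_eq_sum_box_add_tsum_compl (δ := 0) zero_le_one hs0 (n := 7) (by norm_num) 0
  rw [sum_box_zero] at hsplit
  have hfull : layerSum 0 7 s ≤ (s⁻¹) ^ 7 + 16 / 9 * (s⁻¹) ^ 6 := by
    have h := layerSum_le_of_pos (δ := 0) zero_le_one hsp (d := 6) (by norm_num)
    have e : (8 : ℝ) / ((if (0 : ℕ) = 0 then (3 : ℝ) / 4 else 1 / 3) * ((6 : ℕ) : ℝ)) = 16 / 9 := by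
      norm_num
    rw [e] at h
    exact h
  have hJ : registryCoupling 6 s =
      (layerTerm 0 6 s ((0 : ℤ), (0 : ℤ)) - layerTerm 1 6 s ((0 : ℤ), (0 : ℤ))) +
      ∑' ij : {ij : ℤ × ℤ // ij ∉ box 0},
        (layerTerm 0 6 s ij - 1 / 2 * layerTerm 1 6 s ij - 1 / 2 * layerTerm 1 6 s (-(ij : ℤ × ℤ))) := by
    linarith
  rw [hJ]
  refine (abs_add_le _ _).trans ?_
  have hC : 0 ≤ (317 : ℝ) / 5 := by norm_num
  calc |layerTerm 0 6 s ((0 : ℤ), (0 : ℤ)) - layerTerm 1 6 s ((0 : ℤ), (0 : ℤ))| +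
      |∑' ij : {ij : ℤ × ℤ // ij ∉ box 0},
        (layerTerm 0 6 s ij - 1 / 2 * layerTerm 1 6 s ij - 1 / 2 * layerTerm 1 6 s (-(ij : ℤ × ℤ)))|
      ≤ 317 / 5 * layerTerm 0 7 s ((0 : ℤ), (0 : ℤ)) +
        317 / 5 * ∑' ij : {ij : ℤ × ℤ // ij ∉ box 0}, layerTerm 0 7 s ij := add_le_add h00 htail
    _ = 317 / 5 * layerSum 0 7 s := by rw [hsplit]; ring
    _ ≤ 317 / 5 * ((s⁻¹) ^ 7 + 16 / 9 * (s⁻¹) ^ 6) := by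
        refine mul_le_mul_of_nonneg_left ?_ hC
        linarith

end Literature.MathematicalPhysics.StatisticalMechanics.StackingSums

end
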